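import Summits.AtomisticToContinuum.BoseEinsteinCondensation.Theses.BECInsertionCorrector
import Summits.AtomisticToContinuum.BoseEinsteinCondensation.Theses.BECPhaseQuadratureSumRule
import Summits.AtomisticToContinuum.BoseEinsteinCondensation.Theorems.BECInsertionCorrectorCorrectorClosureReductionToFactors
import Summits.AtomisticToContinuum.BoseEinsteinCondensation.Theorems.BECInsertionCorrectorCorrectorClosureOccupationFloorFK
import Summits.AtomisticToContinuum.BoseEinsteinCondensation.Theorems.BECConjugateDominationNearMinimiserStabilityProof
import Summits.AtomisticToContinuum.BoseEinsteinCondensation.Theorems.BECPhaseQuadratureSumRuleMinimiserRegularity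
import Summits.AtomisticToContinuum.BoseEinsteinCondensation.Theorems.BECInsertionCorrectorCorrectorClosureLongWaveStructureOfSRB
import Summits.AtomisticToContinuum.BoseEinsteinCondensation.Theorems.BECInsertionCorrectorCorrectorClosureDensityUniformDichotomy
import Summits.AtomisticToContinuum.BoseEinsteinCondensation.Theorems.BECInsertionCorrectorCorrectorClosureVolumeBootstrap
import Summits.AtomisticToContinuum.BoseEinsteinCondensation.Theorems.BECInsertionCorrectorCorrectorClosureRemovalEnergyBudget
import Summits.AtomisticToContinuum.BoseEinsteinCondensation.Theorems.BECInsertionCorrectorCorrectorClosureZeroModeFSum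
import Summits.AtomisticToContinuum.BoseEinsteinCondensation.Theorems.BECInsertionCorrectorCorrectorClosureConcentrationOfMoments
import Summits.AtomisticToContinuum.BoseEinsteinCondensation.Theorems.BECInsertionCorrectorCorrectorClosureResponseDictionaryMollifier
import Summits.AtomisticToContinuum.BoseEinsteinCondensation.Theorems.CorrectorClosure.Negative.KacClosureHMinusOneSingleMode
import Literature.MathematicalPhysics.QuantumManyBody.WeightedCorrector
import Summits.AtomisticToContinuum.BoseEinsteinCondensation.Theorems.BECPhaseQuadratureSumRuleSmoothPartner
import HarnessLib.Audit

/-!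
# Line `volume-homotopy-sum-rule-domination` — skeleton v5 for crux `BECInsertionCorrector.CorrectorClosure`
(item stmt-AtomisticToContinuum-12058, route route-AtomisticToContinuum-BECInsertionCorrector; crux-plan seat
planner-cruxplan-stmt-AtomisticToContinuum-12058-volume-homotopy-sum--0, 2026-08-16; card
`Cruxes/CorrectorClosure/Ideas/volume-homotopy-sum-rule-domination.md`, triage r2-1/2/3: pass ×3)

Crux (fixed, by name): `CorrectorClosure := StaticResponseBound → InsertionResidue` (K1 → target).


## v2 (lead a5, 2026-08-17) — what changed since the crux-plan's v1

Wave 1 LANDED three of the seven v1 stubs, now imported from `Theorems/` and used BY NAME in the glue: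
S1 `stub_longWaveStructureOfSRB` (p134130; aux p133450/p133527/p133651 — K1 ⇒ `‖ρ_k†Ψ‖² ≤ 2√(C/2)N` for
every minimiser, Parseval in the box centre), S4 `stub_densityUniformDichotomy` (p135138; aux p134954 —
`dichotomy_of_instances` at `t = 1` in `ρ_L`-dress + the empty-window tail), S5 `stub_volumeBootstrap`
(p135959; aux p135842 — Kato-free: periodic dilation `PeriodicTrialState.dilate` + local constancy of `n₀`
+ `isPreconnected_Ici`). S6 `stub_removalFidelity` is RESHAPED into the zero-mode removal module of the
sibling line: B `stub_removalEnergyBudget` (LANDED p135833; aux p135686) + R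
`stub_regularRemovalSusceptibility` (open, verbatim the sibling's registered signature) + the proved
Kipnis–Varadhan sandwich `removalFidelity_of_moments` (copied verbatim). Stubs now (4): S2, S3 (density-
uniform hearts 12615′/12616′), R (regular zero-mode removal susceptibility), S7 (non-smooth-class hole).

## v3 (lead a5, 2026-08-17) — S3 reshaped into the zero-mode moment module

S3 `stub_condensateNumberConcentrationUniform` (12616′) ⇐ S3a `stub_zeroModeFSum` (PQSR's foreseen `ZeroModeFSum`,
provable) ∧ S3b `stub_zeroModeSusceptibility` (the heart: static susceptibility of `N̂₀`, open) via S3g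
`stub_concentrationOfMoments` (provable: phase rigidity + zero-mode dictionary + Kipnis–Varadhan sandwich) — the same
sandwich as the removal module. The two sorry-free reductions of v2 are LANDED and importable:
`periodicBEC_of_densityUniformHearts` / `removalFidelity_of_regularRemovalSusceptibility` (p136219) and the composition
`correctorClosure_of_densityUniformHearts` (p136384). Stubs now (6): S2, S3a, S3b, S3g, R, S7; open hearts S2, S3b, R.

## v4 (lead a5, 2026-08-17) — wave 2 landed S3a and S3g

S3a `stub_zeroModeFSum` LANDED (p138165; aux p137750/p137883/p138021; stronger than asked: `𝓔_{|Φ|}(g_Φ,g_Φ) ≤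
2‖v‖₁N(N−1)/L³` at EVERY `(n, L)`, no energy budget — after `[T,N̂₀] = 0` and `[P_j, v_{kl}] = 0` only the pair slots
survive) and S3g `stub_concentrationOfMoments` LANDED (p137298; aux p137164 phase rigidity `Ψ = cΦ`, p137184 the zero-mode
dictionary `‖N̂₀Φ‖² = pair term + n₀`), both imported by name. Stubs now (4), ALL crux-sized and held by the lead: S2
(12615′, IR 4-point remainders), S3b (static susceptibility of `N̂₀`; sufficient condition `torus gap ≥ C/L³` ⇒ S3b LANDED
p139068), R (regular zero-mode removal susceptibility), S7 (hole).

## v5 (lead a5, 2026-08-17) — the hole S7 made precise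

S7 `stub_nonSmoothClassCase` ⇐ S7a `stub_periodicScatteringLengthTransfer` (torus twin of items 4285/9048, fed by the PROVED
`smoothPartner_proof` 12628 and this line's own chain at the smooth partner) ∧ S7b `stub_unboundedCase` (the shared hard-core hole,
verbatim) — glue inside `CorrectorClosure_of` (sorry-free). Milestone compositions landed: p139349
(`periodicBEC_of_K1_remainders_gap`, `correctorClosure_of_K1_remainders_gap_removal`). Stubs now (5), all crux-sized, held:
S2 (12615′), S3b (N̂₀ susceptibility; ⇐ torus gap ≫ L⁻³, p139068), R (removal susceptibility), S7a (periodic a-transfer), S7b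
(unbounded case).

## The line in one paragraph

Kernel-checked frame (p121285/p122159): modulo K1 the crux sits between `PeriodicBEC` and
`PeriodicBEC ∧ RemovalFidelity ∧ (hard-core case)`; every earlier line died at `K1 → PeriodicBEC` with no
density-sector ⇒ one-body-sector device. THIS line's device: K1 is EXACTLY the Gaussian-domination input
for the DENSITY quadrature of the sum-rule chain of route `BECPhaseQuadratureSumRule` (PQSR) — by the landed
kill-edge `hyperuniformity_of_staticResponseBound` it gives the Onsager–Price bound `‖ρ_k†Ψ‖² ≤ √(2C)·N`
for every torus minimiser at every `(N, L)` with `N/L³ < ρ₀(v)`, hence the body of PQSR's density input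
`LongWaveStructureBound` (item 12617) at coupling `t = 1`, uniformly in the density (stub S1, provable
now) — while the PHASE quadrature is dominated hypothesis-free by the f-sum rule (`m₋₁(k̂·𝒥_k) = N`) and
the proved cubic sum rule `CurrentSumRule` (12618). PQSR's engine `SumRuleChainGlue` (12627, PROVED) runs a
bootstrap in the COUPLING `t ∈ (0,1]`, which K1 cannot feed (its constants are per potential). The new
move is the change of homotopy parameter: at FIXED `N` run the side `L` from `∞` down to `(N/ρ)^{1/3}`;
along that path K1 as typed holds with ONE constant (`∀ ρ < ρ₀, ∀ N` ≡ every `(N, L)` with `N/L³ < ρ₀`),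
the anchor `x(L) → 1` is the trivial bound `1 − x ≤ N‖v‖₁/(8π²L)`, and continuity in `L` is Kato
(stub S5). The engine re-instantiated in `(ρ_L = N/L³, t = 1)` dress (stub S4) turns S1 and the two
density-uniform hearts S2 = 12615′ (`NonCondensateRemainders`, summed 4-point remainders of the
c-number split) and S3 = 12616′ (`CondensateNumberConcentration`, `Var N̂₀ ≤ ζN²`) into the dichotomy
`x(1−x) < 3/16` at EVERY `L ≥ (N/ρ₀)^{1/3}`; S5 (connectedness of `[L₀,∞)`) gives `x ≥ 3/4` for the
minimisers; the proved `NearMinimiserStability` (11788) gives the PeriodicBEC body with `c = 1/2` on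
PQSR's smooth class (glue `periodicBEC_of_chain`, sorry-free). The route-specific removal factor is the
shared stub S6 (`stub_removalFidelity`, verbatim the registered signature of `residue_area_law` v6.1; the
sibling card zero-mode-removal-susceptibility decomposes it), and everything outside the smooth bounded
class — hard cores, kinks, edge-condition failures — is ONE declared hole S7 (`stub_nonSmoothClassCase`,
the widening of the shared `stub_unboundedCase` forced by the `C²` + edge hypothesis of `CurrentSumRule`).
The composition `CorrectorClosure_of` is a per-`v` copy of the landed `correctorClosure_of_factors`
(p122159) and concludes the crux BY NAME.

## Stubs (7) — sizes, status

* S1 `stub_longWaveStructureOfSRB` — K1 ⇒ 12617-body at `t = 1`, ALL `N ≥ 1`, all `L` with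
  `N/L³ < ρ₀` [L; provable now: `hyperuniformity_of_staticResponseBound` + nondegeneracy + Parseval in the
  sliding-box centre]. The ONLY place K1 is consumed in the BEC factor.
* S2 `stub_nonCondensateRemaindersUniform` — 12615′ [heart, open-problem; PQSR 12615 with `t = 1` and
  `∀ L ≥ sideLength ρ₀ N`].
* S3 `stub_condensateNumberConcentrationUniform` — 12616′ [heart, XL; PQSR 12616 likewise].
* S4 `stub_densityUniformDichotomy` — the engine: S1-output ∧ S2 ∧ S3 ⇒ `n₀ ∉ (N/4, 3N/4)` for every
  minimiser at every `L ≥ sideLength ρ₀ N`, `N` large [L; PQSR 12627 (i)–(v) with `ρ_L` for `ρ`, no `t`].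
* S5 `stub_volumeBootstrap` — dichotomy on `[L₀, ∞)` ⇒ `n₀ ≥ 3N/4` on `[L₀, ∞)` [L; Kato continuity of
  `L ↦ n₀(Ψ_{N,L})` for the nondegenerate torus ground state + dilute anchor + IVT].
* S6 `stub_removalFidelity` — K1 ⇒ removal-fidelity floor, bounded `v` [XL, open; SHARED verbatim with
  line residue-area-law v6.1 / card zero-mode-removal-susceptibility].
* S7 `stub_nonSmoothClassCase` — K1 ⇒ the target body for `v` outside (PQSR smooth class ∧ bounded)
  [XL hole; subsumes the shared `stub_unboundedCase`; foreseen split: periodic equal-scattering-length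
  transfer among bounded potentials (cf. item 4285) + hard-core FK frame].

## Disproof.lean (gen 4 v10) — obligations honoured

§1 K1 is consumed BY NAME in S1 (and threads S6/S7); §3/§7 the window on `Ψ` and `δ` after `N` live only
in the fixed-`N` supports (`stub_nearMinimiserRigidity`, `NearMinimiserStability`); §4 `E₀^per ≠ ⊤` is a
hypothesis of every minimiser clause; §5/§8 constants: `x ≥ 3/4`, `c = 1/2`, then `c·c₂/2 < 1`; free gas
`x ≡ 1`; §10 every density threshold is `∃ ρ₀ > 0`, and S2–S4 only assert things at `N/L³ ≤ ρ₀`; §11 the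
free K1 constant `C = 1` gives `S ≤ √2`, consistent; §13 the `d = 3` input is the IR sum `Σ_{IR} 1/|k|`
inside S4 (and S2), exactly where the catalogue puts it; §16 no `H₋₁` claim below `S(k)²/2` (S1 is an
UPPER bound on `S`). No `-- Targets` theorem of v10 names a stub of this line; no landed `Negative/*` lemma
is instantiated by any stub (they concern windowless/uniform-window targets, `∀ρ`, `c > 1`, FS arcs).
-/

noncomputable section

open MeasureTheory Filter Matrix
open scoped ENNReal NNReal BigOperators ComplexConjugate

namespace Summit.AtomisticToContinuum.BoseEinsteinCondensation.Cruxes.CorrectorClosure.VolumeHomotopySumRuleDomination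

open Literature.MathematicalPhysics.QuantumManyBody.BoseGas
open Summit.AtomisticToContinuum.BoseEinsteinCondensation.Theses.BECInsertionCorrector
open Summit.AtomisticToContinuum.BoseEinsteinCondensation.Theorems
  (phaseQuadrature_nearMinimiserStability_proof minimiserRegularity_proof smoothPartner_proof)
open Summit.AtomisticToContinuum.BoseEinsteinCondensation.Theorems.CorrectorClosure.Negative
  (sideLength_succ_pos)
open Summit.AtomisticToContinuum.BoseEinsteinCondensation.Theorems.CorrectorClosure.ResidueAreaLaw
  (stub_groundStateExists stub_occupationFloorFK_of_window taggedZeroModeOccupation_ofReal_eq)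
open Summit.AtomisticToContinuum.BoseEinsteinCondensation.Theorems.CorrectorClosure.HealingScaleKacInsertion
  (stub_nearMinimiserRigidity)
open Summit.AtomisticToContinuum.BoseEinsteinCondensation.Theorems.CorrectorClosure.VolumeHomotopySumRuleDomination
  (stub_longWaveStructureOfSRB stub_densityUniformDichotomy stub_volumeBootstrap stub_zeroModeFSum
    stub_concentrationOfMoments)
open Summit.AtomisticToContinuum.BoseEinsteinCondensation.Theorems.CorrectorClosure.ZeroModeRemovalSusceptibility
  (stub_removalEnergyBudget)
open Summit.AtomisticToContinuum.BoseEinsteinCondensation.Theorems.CorrectorClosure.Negative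
  (sq_integral_sq_le_of_hMinusOneSqW_le)
open Summit.AtomisticToContinuum.BoseEinsteinCondensation.Theorems.CorrectorClosure.HealingScaleKacInsertion.ResponseDictionary
  (integral_sq_eq_one_of_fk)

set_option linter.unusedVariables false

/-! ## Conventions of the signatures

The SMOOTH CLASS is PQSR's: `v` finite (`∀ r, v r ≠ ⊤`), `x ↦ v ‖x‖` of class `C²` on `ℝ³` with the edge
condition `‖D²ṽ‖ ≤ Cₑ√ṽ` (the four hypotheses `hfin hC2 hedge` written exactly as in
`Theses.BECPhaseQuadratureSumRule`); the composition additionally asks `∃ M : ℝ≥0, ∀ r, v r ≤ M` (the FK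
frame p92339/p85784/p120721 is typed for bounded `v`; `v` is only ever evaluated at `r ≥ 0`, so this only
excludes artefacts). A MINIMISER at `(N, L)` is `Ψ : PeriodicTrialState N L` with
`periodicEnergy v Ψ = periodicGroundStateEnergy v N L ≠ ⊤`. The local density of the box is
`ρ_L := N/L³` (`sideLength ρ_L N = L`); "density-uniform" means `∀ L ≥ sideLength ρ₀ N`, i.e. every
`ρ_L ≤ ρ₀`, with ONE `N`-threshold. `x := n₀/N`, `n₀ = condensateOccupation N L Ψ.ψ`. All statements are
division-free in `ℝ≥0∞` except inside `ENNReal.ofReal` and the one `/ ENNReal.ofReal (‖k‖⁴)`,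
`/ ENNReal.ofReal (L⁶)` inherited verbatim from items 12615/12616. -/

/-! ## Stubs (the open / delegated lemmas of the line; `sorry` only here) -/

/-- **S2 — HEART 1: density-uniform non-condensate remainders (= PQSR item 12615 with `t = 1` and
`∀ L ≥ sideLength ρ₀ N`; size: open-problem, held by the lead).** For every smooth-class `v` and every
`Λ, ε > 0` there is `ρ₀ > 0` such that for all large `N`, EVERY box `L ≥ (N/ρ₀)^{1/3}` and every minimiser
`Ψ` at `(N, L)`: the sum over the infrared modes `0 < |k| < Λ√(ρ_L a)` (`k = 2πn/L`, `ρ_L = N/L³`) of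
`‖A_k^{nc}Ψ‖²/|k|⁴ + ‖ρ_k^{nc†}Ψ‖²` is `≤ εN²`, where `A_k^{nc} = Σⱼ Qⱼe^{ik·xⱼ}(−2ik·∇ⱼ + |k|²)Qⱼ` and
`ρ_k^{nc†} = Σⱼ Qⱼe^{ik·xⱼ}Qⱼ` (`Q = 1 − |φ₀⟩⟨φ₀|` as cell averages) are the non-condensate parts of the
longitudinal current `[H, ρ_k†]` and of the density — the two 4-point remainders of the c-number split.
Why plausibly true: Bogoliubov `O(|k|⁴N√(ρa³))` resp. `O(N√(ρa³))` per mode (pair currents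
`(u_pv_q − v_pu_q)²` cancel at `k = 0` by momentum conservation), summed `O(Λ³ρa³N²)` — no log; along the
volume path at fixed `N` nothing degenerates: the IR window is EMPTY once `L > NaΛ²/(4π²)` (sum `= 0`),
and more dilute is more condensed. What it adds over 12615: ONE `N`-threshold for all densities `≤ ρ₀`
(needed by the homotopy at fixed `N`) and no `t`-uniformity. Why it might fail: 4-point functions of the
depletion with no a-priori handle; a `log L` in the current remainder at `k = 2π/L` breaks `ε`; it is not
density-sector (it excludes condensation smeared over the `≪ N` IR modes — lead a4 / triage r2-2), so K1
cannot feed it (declared). Not refutable through the crux (Disproof §1); cheapest falsifier: PQSR's ED rig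
at `t = 1` over several `L` (triage r2-2/3). Leans on: nothing landed (typed next door to item 12615 so
the two routes can pool proof/refutation traffic — recommend filing it as a shared item 12615′).
[cite: LiebSeiringerYngvason2005, Thm 6.2 (c-number substitution); Stringari1995, §2.3 (19)–(23);
GiorginiPitaevskiiStringari1998, (12)–(14)] -/
theorem stub_nonCondensateRemaindersUniform (v : ℝ → ℝ≥0∞) (hv : IsRepulsiveFiniteRange v)
    (hfin : ∀ r, v r ≠ ⊤) (hC2 : ContDiff ℝ 2 (fun x : Space => (v ‖x‖).toReal))
    (hedge : ∃ Cₑ : ℝ, ∀ x : Space,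
      ‖iteratedFDeriv ℝ 2 (fun x : Space => (v ‖x‖).toReal) x‖ ≤ Cₑ * Real.sqrt ((v ‖x‖).toReal)) :
    ∀ Λ : ℝ, 0 < Λ → ∀ ε : ℝ, 0 < ε → ∃ ρ₀ : ℝ, 0 < ρ₀ ∧ ∀ᶠ N : ℕ in atTop, ∀ L : ℝ,
      sideLength ρ₀ N ≤ L → ∀ Ψ : PeriodicTrialState N L,
        periodicEnergy v Ψ = periodicGroundStateEnergy v N L → periodicEnergy v Ψ ≠ ⊤ →
        (∑' n : Fin 3 → ℤ,
          {n : Fin 3 → ℤ | n ≠ 0 ∧ ‖((2 * Real.pi / L) • latticeVec 1 n)‖ <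
              Λ * Real.sqrt ((N : ℝ) / L ^ 3 * (scatteringLength v).toReal)}.indicator
            (fun n =>
              (∫⁻ X in cellN N L,
                  (‖∑ j : Fin N,
                      (cellWave L n (X j) *
                          ((-2 * Complex.I) * fderiv ℝ Ψ.ψ X (Pi.single j ((2 * Real.pi / L) • latticeVec 1 n)) +
                            (((‖((2 * Real.pi / L) • latticeVec 1 n)‖ ^ 2 : ℝ)) : ℂ) *
                              (Ψ.ψ X - (((L ^ 3)⁻¹ : ℝ) : ℂ) * ∫ y in cell L, Ψ.ψ (Function.update X j y))) +
                        (((‖((2 * Real.pi / L) • latticeVec 1 n)‖ ^ 2 : ℝ)) : ℂ) *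
                          ((((L ^ 3)⁻¹ : ℝ) : ℂ) *
                            ∫ y in cell L, cellWave L n y * Ψ.ψ (Function.update X j y)))‖₊ : ℝ≥0∞) ^ 2) /
                  ENNReal.ofReal (‖((2 * Real.pi / L) • latticeVec 1 n)‖ ^ 4) +
                (∫⁻ X in cellN N L,
                  (‖∑ j : Fin N,
                      (cellWave L n (X j) *
                          (Ψ.ψ X - (((L ^ 3)⁻¹ : ℝ) : ℂ) * ∫ y in cell L, Ψ.ψ (Function.update X j y)) -
                        (((L ^ 3)⁻¹ : ℝ) : ℂ) *
                          ∫ y in cell L, cellWave L n y * Ψ.ψ (Function.update X j y))‖₊ : ℝ≥0∞) ^ 2))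
            n) ≤
          ENNReal.ofReal (ε * (N : ℝ) ^ 2) := by
  sorry

/-! ### v3 reshape of S3 (12616′) into the zero-mode moment module {S3a f-sum, S3b susceptibility, S3g glue}

Notation for a real non-negative nowhere-vanishing minimiser `Φ : PeriodicTrialState (n+2) L` (it exists for the
smooth class: `PositiveMinimiser_proof`, item 11787; every minimiser is `e^{iθ}Φ` by nondegeneracy): the
ZERO-MODE COUNTING RATIO `g_Φ(X) := (N̂₀Φ)(X)/Φ(X)`, `(N̂₀Φ)(X) = Σⱼ L⁻³ ∫_cell Φ(X with xⱼ ↦ y) dy`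
(`N̂₀ = Σⱼ Pⱼ`, `Pⱼ` the constant-mode projection in particle `j`), written inline as
`fun X => (∑ j, (L ^ 3)⁻¹ * ∫ y in cell L, ‖Φ.ψ (Function.update X j y)‖) / ‖Φ.ψ X‖`, its `|Φ|²`-mean
`⟨g_Φ⟩ = ∫ g_Φ |Φ|² = ⟨Φ, N̂₀Φ⟩ = n₀(Φ)`, and its centring `g_Φ − ⟨g_Φ⟩`.  Ground-state representation:
`‖(N̂₀ − n₀)Φ‖² = Var_Φ N̂₀ = ∫ (g_Φ − ⟨g_Φ⟩)² |Φ|²`, `m₁(N̂₀) = ⟨N̂₀Φ,(H − E₀)N̂₀Φ⟩ = 𝓔_{|Φ|}(g_Φ, g_Φ)`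
(`dirichletFormW`), `m₋₁(N̂₀ − n₀) = ‖g_Φ − ⟨g_Φ⟩‖²₋₁` (`hMinusOneSqW`).  Kipnis–Varadhan's criterion
(`sq_integral_sq_le_of_hMinusOneSqW_le`) is the uncertainty sandwich `Var² ≤ m₋₁ · m₁` — the SAME structure as
the removal module {B, R}; PQSR's two-layer plan for 12616 (`ZeroModeFSum → ZeroMomentumSectorGap`, Theses
file of route BECPhaseQuadratureSumRule) is this split with the susceptibility in place of a gap. -/

/-- **S3b — ZERO-MODE (CONDENSATE-NUMBER) SUSCEPTIBILITY (the genuine heart of 12616′; size XL, OPEN, held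
by the lead).** For every smooth-class `v`, every `ζ > 0` and every f-sum constant `A ≥ 0` there is `ρ₀ > 0`
such that for all large `n`, every `L ≥ sideLength ρ₀ (n+2)` and every real non-negative nowhere-vanishing `C³`
minimiser `Φ`: the centred zero-mode counting ratio has FINITE Kipnis–Varadhan `H₋₁` norm for the weight `|Φ|`
and `A ρ_L N · ‖g_Φ − ⟨g_Φ⟩‖²₋₁ ≤ (ζN²)²`, `N = n+2`, division-free as `∃ B ≥ 0, hMinusOneSqW ≤ B ∧ AρN·B ≤ (ζN²)²`.
Dictionary: `‖g_Φ − ⟨g_Φ⟩‖²₋₁ = m₋₁(N̂₀ − n₀) = ⟨(N̂₀−n₀)Φ, (H−E₀)⁻¹(N̂₀−n₀)Φ⟩` = the static susceptibility of the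
condensate number; with S3a the sandwich gives `Var N̂₀ ≤ ζN²` (S3g). Room: Bogoliubov
`m₋₁ = Σ_k (u_kv_k)²/(2e_k)·4 ∼ N log(L/ξ)/(ρc_s³…)`, allowance `ζ²N³/(Aρ)` — a factor `∼ N²/log N`; finiteness at
fixed `(N, L)` is the weighted Poincaré inequality for `|Φ|²`. Why it might fail: a two-branch (cat) ground
state (`m₋₁ ∼ N⁴/Δ_cat`; barrier `SymmetryBreakingWithoutCondensate`, conceded — the same object as PQSR's
foreseen `ZeroMomentumSectorGap`, typed as a susceptibility instead of a gap). K1 is silent here (`N̂₀` is not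
a density functional). SUFFICIENT CONDITION LANDED (p139068, `zeroModeSusceptibility_of_torusGap`, same Theorems
namespace): the bosonic torus Ky Fan gap `kyFanTwo v (n+2) L ≥ 2E₀ + C/L³` for EVERY `C`, density-uniformly (PQSR's foreseen
`ZeroMomentumSectorGap` in Ky Fan dress; expected gap `≈ e_{2π/L} ≥ 4π²/L² ≫ C/L³`) implies this stub (weighted Poincaré:
`‖g_c‖²₋₁ ≤ N²/γ`). Leans on: nothing landed. [cite: GiorginiPitaevskiiStringari1998, (14)]
[cite: PitaevskiiStringari1991, (9)] -/
theorem stub_zeroModeSusceptibility (v : ℝ → ℝ≥0∞) (hv : IsRepulsiveFiniteRange v)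
    (hfin : ∀ r, v r ≠ ⊤) (hC2 : ContDiff ℝ 2 (fun x : Space => (v ‖x‖).toReal))
    (hedge : ∃ Cₑ : ℝ, ∀ x : Space,
      ‖iteratedFDeriv ℝ 2 (fun x : Space => (v ‖x‖).toReal) x‖ ≤ Cₑ * Real.sqrt ((v ‖x‖).toReal)) :
    ∀ ζ : ℝ, 0 < ζ → ∀ A : ℝ, 0 ≤ A → ∃ ρ₀ : ℝ, 0 < ρ₀ ∧ ∀ᶠ n : ℕ in atTop, ∀ L : ℝ,
      sideLength ρ₀ (n + 2) ≤ L → ∀ Φ : PeriodicTrialState (n + 2) L,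
        periodicEnergy v Φ = periodicGroundStateEnergy v (n + 2) L → periodicEnergy v Φ ≠ ⊤ →
        ContDiff ℝ 3 Φ.ψ → (∀ X, Φ.ψ X = (‖Φ.ψ X‖ : ℂ)) → (∀ X, Φ.ψ X ≠ 0) →
        ∃ B : ℝ, 0 ≤ B ∧
          hMinusOneSqW L (fun X => ‖Φ.ψ X‖)
              (fun X => (∑ j, (L ^ 3)⁻¹ * ∫ y in cell L, ‖Φ.ψ (Function.update X j y)‖) / ‖Φ.ψ X‖ -
                ∫ Y in cellN (n + 2) L,
                  (∑ j, (L ^ 3)⁻¹ * ∫ y in cell L, ‖Φ.ψ (Function.update Y j y)‖) / ‖Φ.ψ Y‖ *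
                    ‖Φ.ψ Y‖ ^ 2) ≤ ENNReal.ofReal B ∧
          A * (((n : ℝ) + 2) / L ^ 3) * ((n : ℝ) + 2) * B ≤ (ζ * ((n : ℝ) + 2) ^ 2) ^ 2 := by
  sorry

/-- **12616′ at `v` from the zero-mode moment module** (v3/v4: replaces the v1/v2 stub
`stub_condensateNumberConcentrationUniform`; one line over the LANDED S3g `stub_concentrationOfMoments` (p137298) and S3a
`stub_zeroModeFSum` (p138165) and the open heart S3b). [folklore] -/
theorem condensateNumberConcentration_of_moments (v : ℝ → ℝ≥0∞) (hv : IsRepulsiveFiniteRange v)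
    (hfin : ∀ r, v r ≠ ⊤) (hC2 : ContDiff ℝ 2 (fun x : Space => (v ‖x‖).toReal))
    (hedge : ∃ Cₑ : ℝ, ∀ x : Space,
      ‖iteratedFDeriv ℝ 2 (fun x : Space => (v ‖x‖).toReal) x‖ ≤ Cₑ * Real.sqrt ((v ‖x‖).toReal)) :
    ∀ ζ : ℝ, 0 < ζ → ∃ ρ₀ : ℝ, 0 < ρ₀ ∧ ∀ᶠ n : ℕ in atTop, ∀ L : ℝ, sideLength ρ₀ (n + 2) ≤ L →
      ∀ Ψ : PeriodicTrialState (n + 2) L,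
      periodicEnergy v Ψ = periodicGroundStateEnergy v (n + 2) L → periodicEnergy v Ψ ≠ ⊤ →
      ((n + 2 : ℕ) : ℝ≥0∞) * ((n + 1 : ℕ) : ℝ≥0∞) *
      (∫⁻ Y in cellN n L,
      (‖∫ x in cell L, ∫ y in cell L, Ψ.ψ (vecCons x (vecCons y Y))‖₊ : ℝ≥0∞) ^ 2) /
      ENNReal.ofReal (L ^ 6) +
      condensateOccupation (n + 2) L Ψ.ψ ≤
      condensateOccupation (n + 2) L Ψ.ψ ^ 2 + ENNReal.ofReal (ζ * ((n : ℝ) + 2) ^ 2) :=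
  stub_concentrationOfMoments v hv hfin hC2 hedge (stub_zeroModeFSum v hv hfin hC2 hedge)
    (stub_zeroModeSusceptibility v hv hfin hC2 hedge)

/-- **S6-R — REGULAR ZERO-MODE REMOVAL SUSCEPTIBILITY (v2 reshape of S6 `stub_removalFidelity` into the
zero-mode removal module {B, R}: B = `stub_removalEnergyBudget` LANDED p135833, R = this stub, OPEN, held by
the lead; signature VERBATIM `ZeroModeRemovalSusceptibility.stub_regularRemovalSusceptibility` of the checked
sibling skeleton `Lines/zero_mode_removal_susceptibility.lean` l.187–202; K1 NOT used — declared).** For every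
BOUNDED repulsive finite-range `v` there is `ρ₃ > 0` such that for `0 < ρ < ρ₃` there is ONE `η ∈ [0,1)`
with, for all large `N` (box `L = sideLength ρ (N+1)`, `v^per` bounded there) and all continuous positive
torus FK ground states `Θ₀` (`N` bodies), `Φ₀` (`N+1` bodies), `G = ∫_cell Φ₀(x,·)dx`: the centred removal
ratio `g_c = G/Θ₀ − ⟨Θ₀,G⟩` has FINITE Kipnis–Varadhan `H₋₁` norm for the weight `Θ₀` and
`μ_{N+1} · ‖g_c‖²₋₁ ≤ η · ∫G²`, `μ_{N+1} = E₀(N+1) − E₀(N)`, written division-free as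
`∃ B ≥ 0, hMinusOneSqW L Θ₀ g_c ≤ B ∧ μ_{N+1}·B ≤ η∫G²`. Dictionary: `‖g_c‖²₋₁ = m₋₁(G_⊥) =
⟨G_⊥,(H_N − E₀(N))⁻¹G_⊥⟩ = sup_{Ξ ⊥ Θ₀} |⟨Ξ,G⟩|²/⟨Ξ,(H_N−E₀)Ξ⟩` (ground-state representation, Kipnis–Landim's
variational formula = the definition of `hMinusOneSqW`), `G_⊥ = G − ⟨Θ₀,G⟩Θ₀` the part of the zero-mode
removal state `a₀Φ₀` orthogonal to the `N`-body ground state: NO `O(N)` PILE-UP OF REMOVAL-STATE SPECTRAL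
WEIGHT BELOW ENERGY `μ` at total momentum `0` (the `k = 0`, pole-removed endpoint of the one-particle-removal
susceptibility; sibling item stmt-AtomisticToContinuum-12620 asks `b± ≤ C/k²` for `k ≠ 0` only).
Why plausibly true: number-conserving Bogoliubov theory gives `μ‖g_c‖²₋₁/∫G² = O(√(ρa³) log(L/ξ)/N) → 0`, a
factor `N/(√(ρa³)log L)` BELOW the allowance `η < 1`; finiteness at fixed `N, L` is the weighted Poincaré
inequality for `Θ₀²` (fixed-volume gap, used only qualitatively). Why it might fail: a two-branch (cat)
ground state makes `m₋₁(G_⊥) ∼ N²/Δ_cat` (barrier `SymmetryBreakingWithoutCondensate`, conceded; the same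
zero-momentum susceptibility controls S3 = 12616′); beyond one loop nothing in print bounds the `k = 0`
removal susceptibility uniformly in `N`. Degenerate cases: `v = 0` ⇒ `G ∥ Θ₀`, `g_c = 0`, `B = 0`;
`μ_{N+1} = 0` ⇒ any finite `B` works. `C⁺ ∧ B ⇒ RemovalFidelity` is PROVED below
(`removalFidelity_of_moments`, verbatim the sibling skeleton's glue). Leans on: `hMinusOneSqW`,
`dirichletFormW` (WeightedCorrector); nothing in the tree supplies it.
[cite: KipnisLandim1999, App. 1 §6 (6.1)] [cite: GuentherEtAl2021, (10)] [cite: PitaevskiiStringari1991, (9)] -/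
theorem stub_regularRemovalSusceptibility (v : ℝ → ℝ≥0∞) (hv : IsRepulsiveFiniteRange v)
    (hbdd : ∃ C : ℝ≥0, ∀ r, v r ≤ C) :
    ∃ ρ₃ : ℝ, 0 < ρ₃ ∧ ∀ ρ : ℝ, 0 < ρ → ρ < ρ₃ → ∃ η : ℝ, 0 ≤ η ∧ η < 1 ∧
      ∀ᶠ N : ℕ in atTop, ∀ (L : ℝ), L = sideLength ρ (N + 1) →
        (∃ C : ℝ≥0, ∀ x, periodizedPotential v L x ≤ C) →
        ∀ (Θ₀ : Config N → ℝ), IsPeriodicGroundStateFK v L Θ₀ → Continuous Θ₀ → (∀ X, 0 < Θ₀ X) →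
        ∀ (Φ₀ : Config (N + 1) → ℝ), IsPeriodicGroundStateFK v L Φ₀ → Continuous Φ₀ →
          (∀ X, 0 < Φ₀ X) →
        ∀ (G : Config N → ℝ), (G = fun X => ∫ x in cell L, Φ₀ (vecCons x X)) →
          ∃ B : ℝ, 0 ≤ B ∧
            hMinusOneSqW L Θ₀ (fun X => G X / Θ₀ X - ∫ Y in cellN N L, Θ₀ Y * G Y) ≤
              ENNReal.ofReal B ∧
            ((periodicGroundStateEnergy v (N + 1) L).toReal
                - (periodicGroundStateEnergy v N L).toReal) * B ≤
              η * ∫ X in cellN N L, G X ^ 2 := by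
  sorry

/-! ### v5 reshape of the hole S7 into two NAMED classical statements: periodic equal-scattering-length transfer (S7a)
and the shared unbounded/hard-core case (S7b = `stub_unboundedCase` verbatim) — glue `nonSmoothClassCase_of_transfer` proved -/

/-- **S7a — PERIODIC EQUAL-SCATTERING-LENGTH TRANSFER (size XL, OPEN; the torus twin of the shared Dirichlet items
stmt-AtomisticToContinuum-4285 / 9048 `ScatteringLengthTransfer`).** For admissible `v` (bounded) and `w` with equal
scattering length, torus BEC of near-minimisers (the body of `PeriodicBEC`, item 8997) transfers from `w` to `v`. Used
with `w :=` the bounded smooth-class partner of `v` (`smoothPartner_proof`, item 12628, PROVED: equal `a`, PQSR class),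
whose torus BEC the chain of this line supplies (K1-consuming). Why plausibly true: it is false iff two dilute gases
of equal `a` differ w.r.t. BEC (LSSY Ch. 2 open question, BEC form); Bogoliubov theory sees only `a` at leading
order. Why it might fail: every proof idea needs an `N`-uniform corrector/monotonicity bound (none known; barrier
`EnergyAsymptoticsWithoutCondensation` — energies agree to LHY order without implying BEC). K1 not used (the
hypothesis `hK1` of the composed branch is threaded to S7b only). [cite: LSSY2005, Ch. 2 after (2.8)]
[cite: LiebYngvason1998, (1.7)] -/
theorem stub_periodicScatteringLengthTransfer (v w : ℝ → ℝ≥0∞) (hv : IsRepulsiveFiniteRange v)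
    (hw : IsRepulsiveFiniteRange w) (hbdd : ∃ M : ℝ≥0, ∀ r, v r ≤ M)
    (ha : scatteringLength v = scatteringLength w)
    (hBECw : (∃ ρ₀ : ℝ, 0 < ρ₀ ∧ ∀ ρ : ℝ, 0 < ρ → ρ < ρ₀ → ∃ c : ℝ, 0 < c ∧ ∀ᶠ N : ℕ in atTop,
        ∃ δ : ℝ≥0∞, 0 < δ ∧ ∀ Ψ : PeriodicTrialState N (sideLength ρ N),
          periodicEnergy w Ψ ≤ periodicGroundStateEnergy w N (sideLength ρ N) + δ →
          ENNReal.ofReal (c * N) ≤ condensateOccupation N (sideLength ρ N) Ψ.ψ)) :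
    (∃ ρ₀ : ℝ, 0 < ρ₀ ∧ ∀ ρ : ℝ, 0 < ρ → ρ < ρ₀ → ∃ c : ℝ, 0 < c ∧ ∀ᶠ N : ℕ in atTop,
        ∃ δ : ℝ≥0∞, 0 < δ ∧ ∀ Ψ : PeriodicTrialState N (sideLength ρ N),
          periodicEnergy v Ψ ≤ periodicGroundStateEnergy v N (sideLength ρ N) + δ →
          ENNReal.ofReal (c * N) ≤ condensateOccupation N (sideLength ρ N) Ψ.ψ) := by
  sorry

/-- **S7b — the UNBOUNDED (hard / singular core) case: the crux itself for unbounded admissible potentials; typed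
VERBATIM as the shared `stub_unboundedCase` of lines healing-scale-kac-insertion / residue-area-law /
zero-mode-removal-susceptibility / insertion-mode-gaussian-domination (size XL, OPEN, undelegated).** For an
admissible `v` that is NOT bounded the tree's torus Feynman–Kac theory has no input (bounded periodised potentials
only). What a proof would need: the hard-core FK frame — connectivity / simple symmetric ground state of the dilute
free region (OPEN IN PRINT at fixed packing fraction, Disproof §16), `E₀^per < ⊤` eventually — and then the bounded
chain IN ITS REMOVAL FORM (B has no Born term), or truncation `v ∧ n ↑ v` with uniform constants. Diluteness
(Disproof §10) respected: `∃ ρ₀ > 0`. [cite: LSSY2005, Thm 2.5 (E₀ < ⊤ via Dyson's lemma)] -/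
theorem stub_unboundedCase (hK1 : StaticResponseBound) (v : ℝ → ℝ≥0∞) (hv : IsRepulsiveFiniteRange v)
    (hub : ¬ ∃ C : ℝ≥0, ∀ r, v r ≤ C) :
    ∃ ρ₀ : ℝ, 0 < ρ₀ ∧ ∀ ρ : ℝ, 0 < ρ → ρ < ρ₀ → ∃ c : ℝ, 0 < c ∧ ∀ᶠ N : ℕ in Filter.atTop,
      ∃ δ : ENNReal, 0 < δ ∧ ∃ Θ : PeriodicTrialState N (sideLength ρ (N + 1)),
        periodicEnergy v Θ ≤ periodicGroundStateEnergy v N (sideLength ρ (N + 1)) + δ ∧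
        ∀ Ψ : PeriodicTrialState (N + 1) (sideLength ρ (N + 1)),
          periodicEnergy v Ψ ≤ periodicGroundStateEnergy v (N + 1) (sideLength ρ (N + 1)) + δ →
          ENNReal.ofReal c ≤ ENNReal.ofReal ((sideLength ρ (N + 1) ^ 3)⁻¹) *
            (‖∫ X in cellN N (sideLength ρ (N + 1)), conj (Θ.ψ X) *
                ∫ x in cell (sideLength ρ (N + 1)), Ψ.ψ (vecCons x X)‖₊ : ℝ≥0∞) ^ 2 := by
  sorry

/-! ## Sorry-free glue 0: the zero-mode removal module (B landed + R stub ⇒ removal fidelity, K1-free) -/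

/-- **The removal Pythagoras identity.** For a cell-normalised continuous positive weight `Θ₀`
(`∫_cell Θ₀² = 1`) and a continuous `G`, the `Θ₀²`-mass of the centred ratio `g_c = G/Θ₀ − ⟨Θ₀,G⟩` is
`‖G_⊥‖² = ∫G² − ⟨Θ₀,G⟩²`. [folklore] -/
theorem integral_centredRatio_sq (L : ℝ) {N : ℕ} {Θ₀ G : Config N → ℝ} (hΘc : Continuous Θ₀)
    (hΘp : ∀ X, 0 < Θ₀ X) (hGc : Continuous G) (m : ℝ) (hm : ∫ X in cellN N L, Θ₀ X * G X = m)
    (hone : ∫ X in cellN N L, Θ₀ X ^ 2 = 1) :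
    ∫ X in cellN N L, (G X / Θ₀ X - m) * (G X / Θ₀ X - m) * Θ₀ X ^ 2 =
      (∫ X in cellN N L, G X ^ 2) - m ^ 2 := by
  have hpt : ∀ X, (G X / Θ₀ X - m) * (G X / Θ₀ X - m) * Θ₀ X ^ 2 =
      G X ^ 2 - 2 * m * (Θ₀ X * G X) + m ^ 2 * Θ₀ X ^ 2 := by
    intro X
    have hne : Θ₀ X ≠ 0 := (hΘp X).ne'
    have h1 : (G X / Θ₀ X - m) * Θ₀ X = G X - m * Θ₀ X := by
      rw [sub_mul, div_mul_cancel₀ _ hne]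
    calc (G X / Θ₀ X - m) * (G X / Θ₀ X - m) * Θ₀ X ^ 2
        = ((G X / Θ₀ X - m) * Θ₀ X) * ((G X / Θ₀ X - m) * Θ₀ X) := by ring
      _ = (G X - m * Θ₀ X) * (G X - m * Θ₀ X) := by rw [h1]
      _ = G X ^ 2 - 2 * m * (Θ₀ X * G X) + m ^ 2 * Θ₀ X ^ 2 := by ring
  simp_rw [hpt]
  have h1 : Integrable (fun X => G X ^ 2) (volume.restrict (cellN N L)) :=
    integrableOn_cellN (hGc.pow 2) L
  have h2 : Integrable (fun X => 2 * m * (Θ₀ X * G X)) (volume.restrict (cellN N L)) :=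
    (integrableOn_cellN (hΘc.mul hGc) L).const_mul (2 * m)
  have h3 : Integrable (fun X => m ^ 2 * Θ₀ X ^ 2) (volume.restrict (cellN N L)) :=
    (integrableOn_cellN (hΘc.pow 2) L).const_mul (m ^ 2)
  have h12 : Integrable (fun X => G X ^ 2 - 2 * m * (Θ₀ X * G X)) (volume.restrict (cellN N L)) :=
    h1.sub h2
  rw [integral_add h12 h3, integral_sub h1 h2, integral_const_mul, integral_const_mul, hm, hone]
  ring

/-- **The removal-fidelity factor from the two moments (v2: replaces S6 `stub_removalFidelity`; the sibling card's
`RemovalSandwich`, kernel-checked, copied verbatim from `Lines/zero_mode_removal_susceptibility.lean`).**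
Stub B (first moment `𝓔_{Θ₀}(g,g) ≤ μ∫G²`) and Stub R (`μ‖g_c‖²₋₁ ≤ η∫G²`, `η < 1` uniform in `N`)
give the `hFid` factor of `correctorClosure_of_factors` with `c₂ = 1 − √η`:
Kipnis–Varadhan's criterion (`sq_integral_sq_le_of_hMinusOneSqW_le`, Disproof §16) applied to the
centred ratio, `𝓔(g_c,g_c) = 𝓔(g,g)` (constants are `𝓔`-null), and the Pythagoras identity yield
`(∫G² − ⟨Θ₀,G⟩²)² ≤ η (∫G²)²`, i.e. `(1 − √η)∫G² ≤ ⟨Θ₀,G⟩²`. K1 is not used. [folklore] -/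
theorem removalFidelity_of_moments (v : ℝ → ℝ≥0∞) (hv : IsRepulsiveFiniteRange v)
    (hbdd : ∃ C : ℝ≥0, ∀ r, v r ≤ C) :
    ∃ ρ₃ : ℝ, 0 < ρ₃ ∧ ∀ ρ : ℝ, 0 < ρ → ρ < ρ₃ → ∃ c₂ : ℝ, 0 < c₂ ∧
      ∀ᶠ N : ℕ in atTop, ∀ (L : ℝ), L = sideLength ρ (N + 1) →
        (∃ C : ℝ≥0, ∀ x, periodizedPotential v L x ≤ C) →
        ∀ (Θ₀ : Config N → ℝ), IsPeriodicGroundStateFK v L Θ₀ → Continuous Θ₀ → (∀ X, 0 < Θ₀ X) →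
        ∀ (Φ₀ : Config (N + 1) → ℝ), IsPeriodicGroundStateFK v L Φ₀ → Continuous Φ₀ →
          (∀ X, 0 < Φ₀ X) →
        ∀ (G : Config N → ℝ), (G = fun X => ∫ x in cell L, Φ₀ (vecCons x X)) →
          ENNReal.ofReal c₂ * ∫⁻ X in cellN N L, ENNReal.ofReal (G X) ^ 2 ≤
            ENNReal.ofReal ((∫ X in cellN N L, Θ₀ X * G X) ^ 2) := by
  obtain ⟨ρ₃, hρ₃, hR⟩ := stub_regularRemovalSusceptibility v hv hbdd
  refine ⟨ρ₃, hρ₃, fun ρ hρ hρlt => ?_⟩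
  obtain ⟨η, hη0, hη1, hRη⟩ := hR ρ hρ hρlt
  have hsη : Real.sqrt η < 1 := by
    rw [← Real.sqrt_one]
    exact Real.sqrt_lt_sqrt hη0 hη1
  refine ⟨1 - Real.sqrt η, by linarith, ?_⟩
  filter_upwards [hRη] with N hRN L hL_def hb Θ₀ hΘ hΘc hΘp Φ₀ hΦ hΦc hΦp G hG_def
  have hL : 0 < L := by
    rw [hL_def]
    exact sideLength_succ_pos hρ N
  -- Stub B: the ratio is a periodic test function and the first-moment budget
  obtain ⟨hg, hbudget⟩ := stub_removalEnergyBudget v hv N L hL hb Θ₀ hΘ hΘc hΘp Φ₀ hΦ hΦc hΦp G hG_def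
  -- Stub R at this `N`
  obtain ⟨B, hB0, hH, hμB⟩ := hRN L hL_def hb Θ₀ hΘ hΘc hΘp Φ₀ hΦ hΦc hΦp G hG_def
  -- notation
  set μ : ℝ := (periodicGroundStateEnergy v (N + 1) L).toReal
      - (periodicGroundStateEnergy v N L).toReal with hμ_def
  set m : ℝ := ∫ Y in cellN N L, Θ₀ Y * G Y with hm_def
  set S : ℝ := ∫ X in cellN N L, G X ^ 2 with hS_def
  set g : Config N → ℝ := fun X => G X / Θ₀ X with hg_def
  set gc : Config N → ℝ := fun X => G X / Θ₀ X - m with hgc_def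
  -- positivity and continuity of the removal amplitude
  have hG0 : ∀ X, 0 ≤ G X := fun X => by
    rw [hG_def]
    exact setIntegral_nonneg (measurableSet_cell L) fun x _ => (hΦp _).le
  have hGc : Continuous G := by
    have h : Continuous fun X => g X * Θ₀ X := hg.continuous.mul hΘc
    have heq : (fun X => g X * Θ₀ X) = G := funext fun X => div_mul_cancel₀ (G X) (hΘp X).ne'
    rwa [heq] at h
  have hS0 : 0 ≤ S := integral_nonneg fun X => sq_nonneg (G X)
  -- the centred ratio is a periodic test function with the same Dirichlet energy
  have hgc_eq : gc = g - fun _ => m := rfl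
  have hgc : IsPeriodicTest L gc := by
    rw [hgc_eq]
    exact hg.sub (IsPeriodicTest.const L m)
  have hD : dirichletFormW L Θ₀ gc gc = dirichletFormW L Θ₀ g g := by
    rw [hgc_eq, dirichletFormW_sub_sub hΘc hg (IsPeriodicTest.const L m), dirichletFormW_const_right,
      dirichletFormW_const_left]
    ring
  -- Kipnis–Varadhan's criterion (the sandwich): `P² ≤ B · 𝓔(g_c, g_c)`
  set P : ℝ := ∫ X in cellN N L, gc X * gc X * Θ₀ X ^ 2 with hP_def
  have hP0 : 0 ≤ P := integral_nonneg fun X => mul_nonneg (mul_self_nonneg _) (sq_nonneg _)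
  have hKV : P ^ 2 ≤ B * dirichletFormW L Θ₀ gc gc := sq_integral_sq_le_of_hMinusOneSqW_le hgc hB0 hH
  -- combine with the two moment bounds: `P² ≤ η S²`
  have hP2 : P ^ 2 ≤ η * S ^ 2 := by
    calc P ^ 2 ≤ B * dirichletFormW L Θ₀ gc gc := hKV
      _ = B * dirichletFormW L Θ₀ g g := by rw [hD]
      _ ≤ B * (μ * S) := mul_le_mul_of_nonneg_left hbudget hB0
      _ = (μ * B) * S := by ring
      _ ≤ (η * S) * S := mul_le_mul_of_nonneg_right hμB hS0
      _ = η * S ^ 2 := by ring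
  have hPle : P ≤ Real.sqrt η * S := by
    have h1 : P ^ 2 ≤ (Real.sqrt η * S) ^ 2 := by
      rw [mul_pow, Real.sq_sqrt hη0]
      exact hP2
    calc P = Real.sqrt (P ^ 2) := (Real.sqrt_sq hP0).symm
      _ ≤ Real.sqrt ((Real.sqrt η * S) ^ 2) := Real.sqrt_le_sqrt h1
      _ = Real.sqrt η * S := Real.sqrt_sq (mul_nonneg (Real.sqrt_nonneg η) hS0)
  -- Pythagoras: `P = S − m²`
  have hone : ∫ X in cellN N L, Θ₀ X ^ 2 = 1 := integral_sq_eq_one_of_fk hΘ hΘc hL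
  have hPyth : P = S - m ^ 2 := integral_centredRatio_sq L hΘc hΘp hGc m hm_def.symm hone
  have h2 : S - m ^ 2 ≤ Real.sqrt η * S := by
    rw [← hPyth]
    exact hPle
  have hfloor : (1 - Real.sqrt η) * S ≤ m ^ 2 := by
    have h3 : (1 - Real.sqrt η) * S = S - Real.sqrt η * S := by ring
    rw [h3]
    linarith
  -- conversion to the `ℝ≥0∞` currency of the factor
  have hGi : Integrable (fun X => G X ^ 2) (volume.restrict (cellN N L)) :=
    integrableOn_cellN (hGc.pow 2) L
  have hconv : ∫⁻ X in cellN N L, ENNReal.ofReal (G X) ^ 2 = ENNReal.ofReal S := by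
    rw [hS_def, ofReal_integral_eq_lintegral_ofReal hGi (ae_of_all _ fun X => sq_nonneg (G X))]
    exact lintegral_congr fun X => (ENNReal.ofReal_pow (hG0 X) 2).symm
  rw [hconv, ← ENNReal.ofReal_mul (sub_nonneg.2 hsη.le)]
  exact ENNReal.ofReal_le_ofReal hfloor

/-! ## Sorry-free glue I: the volume homotopy ⇒ torus BEC on the smooth class (the line's own composition) -/

/-- `L_N(ρ) = (N/ρ)^{1/3}` is positive for `ρ > 0`, `N ≥ 1`. [folklore] -/
theorem sideLength_pos_of_pos' {ρ : ℝ} (hρ : 0 < ρ) {N : ℕ} (hN : 0 < N) : 0 < sideLength ρ N :=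
  Real.rpow_pos_of_pos (div_pos (Nat.cast_pos.2 hN) hρ) _

/-- `L_N(ρ)` decreases with the density: `ρ ≤ ρ' ⇒ L_N(ρ') ≤ L_N(ρ)`. [folklore] -/
theorem sideLength_antitone' {ρ ρ' : ℝ} (hρ : 0 < ρ) (h : ρ ≤ ρ') (N : ℕ) :
    sideLength ρ' N ≤ sideLength ρ N := by
  unfold sideLength
  refine Real.rpow_le_rpow (div_nonneg N.cast_nonneg (hρ.le.trans h)) ?_ (by norm_num)
  exact div_le_div_of_nonneg_left N.cast_nonneg hρ h

/-- **Torus BEC on the smooth class from the five mechanism stubs (kernel-checked glue; `sorry` only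
through S1–S5).** Given K1 and a smooth-class `v`: S4 fed with S1 (at this `v`, K1 consumed there), S2, S3
gives `ρ₀` and an `N`-threshold beyond which every minimiser at every `L ≥ sideLength ρ₀ N` avoids the band
`(N/4, 3N/4)`; for `0 < ρ < ρ₀` and such `N ≥ 1`, S5 on `[sideLength ρ₀ N, ∞) ∋ sideLength ρ N`
(`sideLength_antitone'`) gives `n₀(Ψ) ≥ 3N/4` for the minimiser `Ψ` at `L = sideLength ρ N`
(`minimiserRegularity_proof`, 12619); `NearMinimiserStability` (11788, `phaseQuadrature_nearMinimiserStability_proof`)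
at `ε = 1/4` gives `δ > 0` with `n₀(Φ) ≥ n₀(Ψ) − N/4 ≥ N/2` for every `δ`-near-minimiser `Φ`: the body of
`PeriodicBEC` (item 8997) at `v` with `c = 1/2`. [folklore] -/
theorem periodicBEC_of_chain (hK1 : StaticResponseBound) (v : ℝ → ℝ≥0∞)
    (hv : IsRepulsiveFiniteRange v) (hfin : ∀ r, v r ≠ ⊤)
    (hC2 : ContDiff ℝ 2 (fun x : Space => (v ‖x‖).toReal))
    (hedge : ∃ Cₑ : ℝ, ∀ x : Space,
      ‖iteratedFDeriv ℝ 2 (fun x : Space => (v ‖x‖).toReal) x‖ ≤ Cₑ * Real.sqrt ((v ‖x‖).toReal)) :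
    ∃ ρ₀ : ℝ, 0 < ρ₀ ∧ ∀ ρ : ℝ, 0 < ρ → ρ < ρ₀ → ∃ c : ℝ, 0 < c ∧ ∀ᶠ N : ℕ in atTop,
      ∃ δ : ℝ≥0∞, 0 < δ ∧ ∀ Ψ : PeriodicTrialState N (sideLength ρ N),
        periodicEnergy v Ψ ≤ periodicGroundStateEnergy v N (sideLength ρ N) + δ →
        ENNReal.ofReal (c * N) ≤ condensateOccupation N (sideLength ρ N) Ψ.ψ := by
  obtain ⟨ρ₀, hρ₀, hev⟩ := stub_densityUniformDichotomy v hv hfin hC2 hedge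
    (stub_longWaveStructureOfSRB hK1 v hv hfin hC2 hedge)
    (stub_nonCondensateRemaindersUniform v hv hfin hC2 hedge)
    (condensateNumberConcentration_of_moments v hv hfin hC2 hedge)
  refine ⟨ρ₀, hρ₀, fun ρ hρ hρlt => ⟨1 / 2, by norm_num, ?_⟩⟩
  filter_upwards [hev, eventually_gt_atTop 0] with N hN hNpos
  set L : ℝ := sideLength ρ N with hL_def
  have hL : 0 < L := sideLength_pos_of_pos' hρ hNpos
  have hL₀pos : 0 < sideLength ρ₀ N := sideLength_pos_of_pos' hρ₀ hNpos
  have hL₀ : sideLength ρ₀ N ≤ L := sideLength_antitone' hρ hρlt.le N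
  -- the bootstrap on `[sideLength ρ₀ N, ∞)`: every minimiser there has `n₀ ≥ 3N/4`
  have h34 := stub_volumeBootstrap v hv hfin hC2 hedge N (sideLength ρ₀ N) hL₀pos
    (fun L' hL' Ψ hE hfinE => hN L' hL' Ψ hE hfinE)
  -- a minimiser at `L = sideLength ρ N`
  obtain ⟨Ψm, hEm, hfinm, -⟩ := minimiserRegularity_proof v hv hfin hC2 hedge N hNpos L hL
  have hE₀ : periodicGroundStateEnergy v N L ≠ ⊤ := by rw [← hEm]; exact hfinm
  have hΨm : ENNReal.ofReal (3 * (N : ℝ) / 4) ≤ condensateOccupation N L Ψm.ψ :=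
    h34 L hL₀ Ψm hEm hfinm
  -- stability of `n₀` under `δ`-near-minimisation at fixed `(N, L)`, `ε = 1/4`
  obtain ⟨δ, hδ, hstab⟩ := phaseQuadrature_nearMinimiserStability_proof v hv hfin hC2 hedge N L hL hE₀
    (1 / 4) (by norm_num)
  refine ⟨δ, hδ, fun Φ hΦ => ?_⟩
  have hst : condensateOccupation N L Ψm.ψ ≤
      condensateOccupation N L Φ.ψ + ENNReal.ofReal (1 / 4 * (N : ℝ)) := hstab Ψm Φ hEm hΦ
  have hsplit : ENNReal.ofReal (3 * (N : ℝ) / 4) =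
      ENNReal.ofReal (1 / 2 * (N : ℝ)) + ENNReal.ofReal (1 / 4 * (N : ℝ)) := by
    rw [← ENNReal.ofReal_add (by positivity) (by positivity)]
    congr 1; ring
  have h2 : ENNReal.ofReal (1 / 2 * (N : ℝ)) + ENNReal.ofReal (1 / 4 * (N : ℝ)) ≤
      condensateOccupation N L Φ.ψ + ENNReal.ofReal (1 / 4 * (N : ℝ)) := by
    rw [← hsplit]; exact hΨm.trans hst
  exact (ENNReal.add_le_add_iff_right ENNReal.ofReal_ne_top).1 h2

/-! ## Sorry-free glue II: the FK frame at ONE potential (per-`v` copy of p122159) -/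

/-- **The residue floor from the two factors, at one bounded potential** (per-`v` form of the landed
`residueFloor_of_factors'`, p122159): torus BEC of near-minimisers at `v` (shifted to index `N+1` and
transferred to the FK ground state `Φ₀` by `stub_occupationFloorFK_of_window`, p120721) and the
removal-fidelity floor at `v` give the `N`-uniform floor `c₁c₂ ≤ A = L⁻³(∫Θ₀G)²`. [folklore] -/
theorem residueFloor_at (v : ℝ → ℝ≥0∞) (hv : IsRepulsiveFiniteRange v)
    (hBEC : ∃ ρ₀ : ℝ, 0 < ρ₀ ∧ ∀ ρ : ℝ, 0 < ρ → ρ < ρ₀ → ∃ c : ℝ, 0 < c ∧ ∀ᶠ N : ℕ in atTop,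
        ∃ δ : ℝ≥0∞, 0 < δ ∧ ∀ Ψ : PeriodicTrialState N (sideLength ρ N),
          periodicEnergy v Ψ ≤ periodicGroundStateEnergy v N (sideLength ρ N) + δ →
          ENNReal.ofReal (c * N) ≤ condensateOccupation N (sideLength ρ N) Ψ.ψ)
    (hFid : ∃ ρ₃ : ℝ, 0 < ρ₃ ∧ ∀ ρ : ℝ, 0 < ρ → ρ < ρ₃ → ∃ c₂ : ℝ, 0 < c₂ ∧
        ∀ᶠ N : ℕ in atTop, ∀ (L : ℝ), L = sideLength ρ (N + 1) →
          (∃ C : ℝ≥0, ∀ x, periodizedPotential v L x ≤ C) →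
          ∀ (Θ₀ : Config N → ℝ), IsPeriodicGroundStateFK v L Θ₀ → Continuous Θ₀ → (∀ X, 0 < Θ₀ X) →
          ∀ (Φ₀ : Config (N + 1) → ℝ), IsPeriodicGroundStateFK v L Φ₀ → Continuous Φ₀ →
            (∀ X, 0 < Φ₀ X) →
          ∀ (G : Config N → ℝ), (G = fun X => ∫ x in cell L, Φ₀ (vecCons x X)) →
            ENNReal.ofReal c₂ * ∫⁻ X in cellN N L, ENNReal.ofReal (G X) ^ 2 ≤
              ENNReal.ofReal ((∫ X in cellN N L, Θ₀ X * G X) ^ 2)) :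
    ∃ ρ₂ : ℝ, 0 < ρ₂ ∧ ∀ ρ : ℝ, 0 < ρ → ρ < ρ₂ → ∃ c : ℝ, 0 < c ∧
      ∀ᶠ N : ℕ in atTop, ∀ (L : ℝ), L = sideLength ρ (N + 1) →
        (∃ C : ℝ≥0, ∀ x, periodizedPotential v L x ≤ C) →
        ∀ (Θ₀ : Config N → ℝ), IsPeriodicGroundStateFK v L Θ₀ → Continuous Θ₀ → (∀ X, 0 < Θ₀ X) →
        ∀ (Φ₀ : Config (N + 1) → ℝ), IsPeriodicGroundStateFK v L Φ₀ → Continuous Φ₀ →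
          (∀ X, 0 < Φ₀ X) →
          ENNReal.ofReal c ≤
            ENNReal.ofReal ((L ^ 3)⁻¹ *
              (∫ X in cellN N L, Θ₀ X * ∫ x in cell L, Φ₀ (vecCons x X)) ^ 2) := by
  obtain ⟨ρ₀, hρ₀, hBEC₀⟩ := hBEC
  obtain ⟨ρ₃, hρ₃, hFid₀⟩ := hFid
  refine ⟨min ρ₀ ρ₃, lt_min hρ₀ hρ₃, fun ρ hρ hρlt => ?_⟩
  have hρ₀' : ρ < ρ₀ := lt_of_lt_of_le hρlt (min_le_left _ _)
  have hρ₃' : ρ < ρ₃ := lt_of_lt_of_le hρlt (min_le_right _ _)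
  obtain ⟨c₁, hc₁, hBECc⟩ := hBEC₀ ρ hρ hρ₀'
  obtain ⟨c₂, hc₂, hFidc⟩ := hFid₀ ρ hρ hρ₃'
  refine ⟨c₁ * c₂, by positivity, ?_⟩
  -- shift the BEC statement to index `N + 1`
  have hBEC' : ∀ᶠ N : ℕ in atTop, ∃ δ : ℝ≥0∞, 0 < δ ∧
      ∀ Ψ : PeriodicTrialState (N + 1) (sideLength ρ (N + 1)),
        periodicEnergy v Ψ ≤ periodicGroundStateEnergy v (N + 1) (sideLength ρ (N + 1)) + δ →
        ENNReal.ofReal (c₁ * ((N : ℝ) + 1)) ≤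
          condensateOccupation (N + 1) (sideLength ρ (N + 1)) Ψ.ψ := by
    have h := (tendsto_add_atTop_nat 1).eventually hBECc
    filter_upwards [h] with N hN
    obtain ⟨δ, hδ, hΨ⟩ := hN
    refine ⟨δ, hδ, fun Ψ hΨE => ?_⟩
    have := hΨ Ψ hΨE
    simpa [Nat.cast_succ] using this
  filter_upwards [hBEC', hFidc] with N hBECN hFidN L hL_def hb Θ₀ hΘ hΘc hΘp Φ₀ hΦ hΦc hΦp
  have hL : 0 < L := by rw [hL_def]; exact sideLength_succ_pos hρ N
  obtain ⟨δ, hδ, hwin⟩ := hBECN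
  set G : Config N → ℝ := fun X => ∫ x in cell L, Φ₀ (vecCons x X) with hG_def
  -- factor 1: `c₁ ≤ f₀(Φ₀)`
  have hf₀ : ENNReal.ofReal c₁ ≤ taggedZeroModeOccupation N L (fun X => (Φ₀ X : ℂ)) := by
    subst hL_def
    exact stub_occupationFloorFK_of_window v hv.1 N _ hL hb Φ₀ hΦ hΦc hΦp c₁ hc₁.le δ hδ hwin
  rw [taggedZeroModeOccupation_ofReal_eq L hΦp] at hf₀
  -- factor 2: `c₂ ∫ G² ≤ (∫ Θ₀ G)²`
  have hF : ENNReal.ofReal c₂ * ∫⁻ X in cellN N L, ENNReal.ofReal (G X) ^ 2 ≤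
      ENNReal.ofReal ((∫ X in cellN N L, Θ₀ X * G X) ^ 2) :=
    hFidN L hL_def hb Θ₀ hΘ hΘc hΘp Φ₀ hΦ hΦc hΦp G rfl
  -- combine: `c₁ c₂ ≤ c₂ · (L³)⁻¹ ∫G² ≤ (L³)⁻¹ (∫Θ₀G)²`
  calc ENNReal.ofReal (c₁ * c₂)
      = ENNReal.ofReal c₂ * ENNReal.ofReal c₁ := by
        rw [ENNReal.ofReal_mul hc₁.le, mul_comm]
    _ ≤ ENNReal.ofReal c₂ * ((ENNReal.ofReal L ^ 3)⁻¹ *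
          ∫⁻ X in cellN N L, ENNReal.ofReal (G X) ^ 2) := by gcongr
    _ = (ENNReal.ofReal L ^ 3)⁻¹ *
          (ENNReal.ofReal c₂ * ∫⁻ X in cellN N L, ENNReal.ofReal (G X) ^ 2) := by ring
    _ ≤ (ENNReal.ofReal L ^ 3)⁻¹ * ENNReal.ofReal ((∫ X in cellN N L, Θ₀ X * G X) ^ 2) := by
        gcongr
    _ = ENNReal.ofReal ((L ^ 3)⁻¹ * (∫ X in cellN N L, Θ₀ X * G X) ^ 2) := by
        rw [ENNReal.ofReal_mul (by positivity), ENNReal.ofReal_inv_of_pos (by positivity),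
          ENNReal.ofReal_pow hL.le]

/-- **The target body at one bounded potential from the two factors** (per-`v` form of the landed
`correctorClosure_of_factors`, p122159): thresholds `min ρᵢ`; eventually in `N` the torus FK ground
states exist, are continuous and positive with `v^per` bounded (`stub_groundStateExists`, p92339); the
floor `c ≤ A` (`residueFloor_at`); rigidity at `ε = c/2` (`stub_nearMinimiserRigidity`, p85784) moves it
to `c/2 ≤ Res(Θ, Ψ)` for some `δ`-near-minimiser `Θ` and every `δ`-near-minimiser `Ψ`. [folklore] -/
theorem insertionResidue_at (v : ℝ → ℝ≥0∞) (hv : IsRepulsiveFiniteRange v)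
    (hbdd : ∃ C : ℝ≥0, ∀ r, v r ≤ C)
    (hBEC : ∃ ρ₀ : ℝ, 0 < ρ₀ ∧ ∀ ρ : ℝ, 0 < ρ → ρ < ρ₀ → ∃ c : ℝ, 0 < c ∧ ∀ᶠ N : ℕ in atTop,
        ∃ δ : ℝ≥0∞, 0 < δ ∧ ∀ Ψ : PeriodicTrialState N (sideLength ρ N),
          periodicEnergy v Ψ ≤ periodicGroundStateEnergy v N (sideLength ρ N) + δ →
          ENNReal.ofReal (c * N) ≤ condensateOccupation N (sideLength ρ N) Ψ.ψ)
    (hFid : ∃ ρ₃ : ℝ, 0 < ρ₃ ∧ ∀ ρ : ℝ, 0 < ρ → ρ < ρ₃ → ∃ c₂ : ℝ, 0 < c₂ ∧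
        ∀ᶠ N : ℕ in atTop, ∀ (L : ℝ), L = sideLength ρ (N + 1) →
          (∃ C : ℝ≥0, ∀ x, periodizedPotential v L x ≤ C) →
          ∀ (Θ₀ : Config N → ℝ), IsPeriodicGroundStateFK v L Θ₀ → Continuous Θ₀ → (∀ X, 0 < Θ₀ X) →
          ∀ (Φ₀ : Config (N + 1) → ℝ), IsPeriodicGroundStateFK v L Φ₀ → Continuous Φ₀ →
            (∀ X, 0 < Φ₀ X) →
          ∀ (G : Config N → ℝ), (G = fun X => ∫ x in cell L, Φ₀ (vecCons x X)) →
            ENNReal.ofReal c₂ * ∫⁻ X in cellN N L, ENNReal.ofReal (G X) ^ 2 ≤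
              ENNReal.ofReal ((∫ X in cellN N L, Θ₀ X * G X) ^ 2)) :
    ∃ ρ₀ : ℝ, 0 < ρ₀ ∧ ∀ ρ : ℝ, 0 < ρ → ρ < ρ₀ → ∃ c : ℝ, 0 < c ∧ ∀ᶠ N : ℕ in Filter.atTop,
      ∃ δ : ENNReal, 0 < δ ∧ ∃ Θ : PeriodicTrialState N (sideLength ρ (N + 1)),
        periodicEnergy v Θ ≤ periodicGroundStateEnergy v N (sideLength ρ (N + 1)) + δ ∧
        ∀ Ψ : PeriodicTrialState (N + 1) (sideLength ρ (N + 1)),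
          periodicEnergy v Ψ ≤ periodicGroundStateEnergy v (N + 1) (sideLength ρ (N + 1)) + δ →
          ENNReal.ofReal c ≤ ENNReal.ofReal ((sideLength ρ (N + 1) ^ 3)⁻¹) *
            (‖∫ X in cellN N (sideLength ρ (N + 1)), conj (Θ.ψ X) *
                ∫ x in cell (sideLength ρ (N + 1)), Ψ.ψ (vecCons x X)‖₊ : ℝ≥0∞) ^ 2 := by
  obtain ⟨ρA, hρA, hGS⟩ := stub_groundStateExists v hv hbdd
  obtain ⟨ρ₂, hρ₂, hFl⟩ := residueFloor_at v hv hBEC hFid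
  refine ⟨min ρA ρ₂, lt_min hρA hρ₂, fun ρ hρ hρlt => ?_⟩
  have hρA' : ρ < ρA := lt_of_lt_of_le hρlt (min_le_left _ _)
  have hρ₂' : ρ < ρ₂ := lt_of_lt_of_le hρlt (min_le_right _ _)
  obtain ⟨c, hc, hFlc⟩ := hFl ρ hρ hρ₂'
  refine ⟨c / 2, by positivity, ?_⟩
  filter_upwards [hGS ρ hρ hρA', hFlc] with N hGSN hFlN
  obtain ⟨hb, ⟨hΘ, hΘc, hΘp⟩, ⟨hΦ, hΦc, hΦp⟩⟩ := hGSN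
  set L : ℝ := sideLength ρ (N + 1) with hL_def
  have hL : 0 < L := sideLength_succ_pos hρ N
  set Θ₀ : Config N → ℝ := periodicFKGroundState v N L with hΘ₀_def
  set Φ₀ : Config (N + 1) → ℝ := periodicFKGroundState v (N + 1) L with hΦ₀_def
  set A : ℝ≥0∞ := ENNReal.ofReal ((L ^ 3)⁻¹ *
      (∫ X in cellN N L, Θ₀ X * ∫ x in cell L, Φ₀ (vecCons x X)) ^ 2) with hA_def
  -- the floor: `c ≤ A`
  have hfloor : ENNReal.ofReal c ≤ A := hFlN L rfl hb Θ₀ hΘ hΘc hΘp Φ₀ hΦ hΦc hΦp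
  -- rigidity at `ε = c/2`: transfer to the near-minimiser frame
  obtain ⟨δ, hδ, Θ, hΘE, hΨ⟩ := stub_nearMinimiserRigidity v hv N L hL hb Θ₀ hΘ hΘc hΘp Φ₀ hΦ hΦc
    hΦp (c / 2) (by positivity)
  refine ⟨δ, hδ, Θ, hΘE, fun Ψ hΨE => ?_⟩
  set R : ℝ≥0∞ := ENNReal.ofReal ((L ^ 3)⁻¹) *
      (‖∫ X in cellN N L, conj (Θ.ψ X) * ∫ x in cell L, Ψ.ψ (vecCons x X)‖₊ : ℝ≥0∞) ^ 2 with hR_def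
  have hAR : A ≤ R + ENNReal.ofReal (c / 2) := hΨ Ψ hΨE
  have hsplit : ENNReal.ofReal c = ENNReal.ofReal (c / 2) + ENNReal.ofReal (c / 2) := by
    rw [← ENNReal.ofReal_add (by positivity) (by positivity)]
    congr 1; ring
  have h2 : ENNReal.ofReal (c / 2) + ENNReal.ofReal (c / 2) ≤ R + ENNReal.ofReal (c / 2) := by
    rw [← hsplit]; exact hfloor.trans hAR
  exact (ENNReal.add_le_add_iff_right ENNReal.ofReal_ne_top).1 h2

/-! ## Composition (sorry-free): the registered stubs give the crux BY NAME -/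

/-- **`CorrectorClosure` from the registered stubs** (kernel-checked glue, no `sorry` of its own).
Case split on the smooth bounded class. INSIDE the class: K1 ⇒ torus BEC of near-minimisers by the
volume-homotopy sum-rule chain (`periodicBEC_of_chain`: S1 consumes K1, S2–S3 the hearts, S4 the engine,
S5 the bootstrap, plus the proved 12619/11788), K1 ⇒ removal fidelity (S6), and the landed fixed-`N` FK
frame (`insertionResidue_at` = p122159 at this `v`). OUTSIDE the class (v5): bounded `v` ⇒ smooth partner `w`
(`smoothPartner_proof`) + the chain at `w` + S7a transfer + the removal module at `v`; unbounded `v` ⇒ S7b. [folklore] -/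
theorem CorrectorClosure_of : CorrectorClosure := by
  intro hK1 v hv
  by_cases hcls : ((∀ r, v r ≠ ⊤) ∧ ContDiff ℝ 2 (fun x : Space => (v ‖x‖).toReal) ∧
      (∃ Cₑ : ℝ, ∀ x : Space,
        ‖iteratedFDeriv ℝ 2 (fun x : Space => (v ‖x‖).toReal) x‖ ≤ Cₑ * Real.sqrt ((v ‖x‖).toReal)) ∧
      (∃ M : ℝ≥0, ∀ r, v r ≤ M))
  · obtain ⟨hfin, hC2, hedge, hbdd⟩ := hcls
    exact insertionResidue_at v hv hbdd (periodicBEC_of_chain hK1 v hv hfin hC2 hedge)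
      (removalFidelity_of_moments v hv hbdd)
  · -- outside the smooth bounded class (v5): bounded ⇒ smooth partner + transfer; unbounded ⇒ S7b
    by_cases hbdd : ∃ M : ℝ≥0, ∀ r, v r ≤ M
    · obtain ⟨w, hw, hwfin, hwC2, hwedge, _, hwa⟩ := smoothPartner_proof v hv
      exact insertionResidue_at v hv hbdd
        (stub_periodicScatteringLengthTransfer v w hv hw hbdd hwa.symm
          (periodicBEC_of_chain hK1 w hw hwfin hwC2 hwedge))
        (removalFidelity_of_moments v hv hbdd)
    · exact stub_unboundedCase hK1 v hv hbdd

end Summit.AtomisticToContinuum.BoseEinsteinCondensation.Cruxes.CorrectorClosure.VolumeHomotopySumRuleDomination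

end
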